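/-
Copyright: the b2b-balaban T⁴-continuum CRUX team, row NE7b OWNER lineage `t4-ne7b-p1` (gen 123). Project licence.
-/
import Summits.QuantumFields.BalabanUV.T4Continuum.Spine.NE7b.SupZdPropagatorUniqueness

/-!
# THE `ℤ^d` COLUMN IS COMPOSABLE: sources with an exponential block profile `|f p| ≤ M·e^{−γ|blk n p − b₀|₁}` have `ℤ^d` solutions with
# `e^{δ|blk n p − b₀|₁}·|u p| ≤ C·M` ((154) at every level of the tower, passed to the limit), and — by UNIQUENESS (181) — the bounded
# `ℤ^d` propagator is Lipschitz in the potential IN THE DECAY CURRENCY: `|V₁ − V₂| ≤ D`, `f` in the block `b₀`, `|f| ≤ M`, `H_{V₁}u₁ = f = H_{V₂}u₂`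
# bounded ⟹ `e^{δ|blk n p − b₀|₁}·|u₁ p − u₂ p| ≤ C·D·M` on ALL of `ℤ^d`, every `V₁, V₂ : ℤ^d → [−λ, Λ]`, `d ≥ 3`, every mesh (row NE7b, node U5c;
# (154)∕(180)∕(181) BY NAME; [folklore])

Cell `pub-balaban`, sub-cell `t4`, spine estimate NE7b (`T4WeightBudget.RelWeightBound`; the cell's OWN estimate — NOT PRINTED in
[Bałaban 1983–89], NOT PROVED).  Crux-route work under `Spine/NE7b/` by the row OWNER (`t4-ne7b-p1` gen 123, file (182)) under FREEZE
(0)'s crux-prover clause; NOTHING of Bałaban's is named as a Lean object, valued or asserted; no `T4Continuum/Support` leaf typed; no `def`,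
no notation (the `ℤ^d` operator DISPLAYED); zero `sorry`.  Imports (BY NAME): the OWNER's (181) `…SupZdPropagatorUniqueness`
(`zd_bounded_null_solution_eq_zero`; through it (180) `tower_limit`, `zd_propagator_exists`, `natAbs_valMinAbs_intCast_of_lt`, `torusDist_eq_l1_of_lt`,
(154) `pointwise_decay_road`, (148) `action_surjective`, (132) `natAbs_valMinAbs_le_of_intCast_eq`, TDF `blockOf_siteOf`).

WHY (located).  (180)∕(181) make the infinite-volume propagator of the road's class an object (existence with decay, uniqueness in `ℓ^∞`).
The torus column was CLOSED UNDER COMPOSITION ((149)∕(154): profile sources) and LIPSCHITZ IN THE BACKGROUND ((141)∕(157)∕(177)); the `ℤ^d`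
column inherits both: profile sources pass through the tower exactly like block sources (the window reading of an `ℓ¹`-profile is a
torus profile, `ρ_k(σ b, σ b₀) ≤ |b − b₀|₁`), and for two bounded solutions `w = u₁ − u₂` solves `H_{V₁}w = −(V₁ − V₂)u₂` — a profile source
by the decay of `u₂` (uniqueness identifies `u₂` with (180)'s decaying solution) — so uniqueness identifies `w` with the decaying solution
of §2.

WHAT IS PROVED ([folklore]; `X d = ℤ^d`; the `ℤ^d` operator `(H_V u)(p) = (n+1)²Σ_μ(2u p − u(p + ê_μ) − u(p − ê_μ)) + a(n+1)^{−d}Σ_{q ∈ B n (blk n p)}u q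
+ V p·u p` DISPLAYED; `|b|₁ = Σ_i|b i|`):
* §1 `torusDist_le_l1` (`ρ_s(σ b, σ c) ≤ |b − c|₁`), `profile_window_reading` (an `ℓ¹` block profile on `ℤ^d` reads as a torus block profile).
* §2 **`zd_solution_of_profile_source`**: `d ≥ 3`, `a > 0`, `λ < min(2,a)`, `Λ ≥ 0`, `γ > 0` ⟹ `∃ C δ > 0`: for ALL `n`, ALL `V : ℤ^d → [−λ, Λ]`,
  every `b₀` and every `|f p| ≤ M·e^{−γ|blk n p − b₀|₁}`: `∃ u`, `H_V u = f` on `ℤ^d`, `e^{δ|blk n p − b₀|₁}·|u p| ≤ C·M` at every `p`.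
* §3 **`zd_propagator_lipschitz_potential`**: `∃ C δ > 0`: for ALL `n`, ALL `V₁, V₂ : ℤ^d → [−λ, Λ]` with `|V₁ − V₂| ≤ D`, every block source
  (`f` in `b₀`, `|f| ≤ M`), all BOUNDED `u₁, u₂` with `H_{V₁}u₁ = f`, `H_{V₂}u₂ = f`: `e^{δ|blk n p − b₀|₁}·|u₁ p − u₂ p| ≤ C·D·M` at every `p`.
* §4 toy (`d = 3`).

HONEST (what this is NOT).  The LINEAR column only; `d ≥ 3` only; constants existential and far from sharp; the response ∕ covariance
objects of the road on `ℤ^d` need the coarse operator in infinite volume (not here); scalar skeleton ((A3), NC-NE7b-α UNRULED); nothing of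
the covariant propagators of [B4]–[B6]; nothing of Bałaban's.  BY-NAME EFFECT ON THE WALL: NONE.  NE7b NOT PRINTED ∕ NOT PROVED; spine PROVED
0∕9; rung (B)+1 — the programme's measures remain FINITE-torus statements; NOT the mass gap, NOT Clay.  HONEST DEPENDENCY: continuum YM on
T⁴ ⇐ BetaPertH ∧ nine spine estimates (0∕9 proved); BetaPertH ⇐ (D1) ∧ (D4) ∧ CAP+tail; G-an2-4 gates asym, D1 and NE2∕3∕4.
-/

set_option autoImplicit false

noncomputable section

namespace Summit.QuantumFields.BalabanUV.T4Continuum.NE7b.SupZdPropagatorProfile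

open Real Filter Topology
open Literature.MathematicalPhysics.QuantumFieldTheory.Balaban1983to89
open B6QGQLower276 (X e blk B side side_facts chart mem_B sum_B sum_B_const card_cube blk_chart)
open Beta (Site siteOf windowMap siteOf_windowMap siteOf_add siteOf_sub InWindow windowMap_siteOf inWindow_windowMap
  inWindow_of_two_mul_abs_lt)
open SupTorusDirichletForm (blockOf_siteOf)
open SupTorusBlockDistance (natAbs_valMinAbs_le_of_intCast_eq)
open SupTorusSupNormBound (action_surjective)
open SupTorusPointwiseDecayRoad (pointwise_decay_road)
open SupZdPropagatorLimit (tower_limit zd_propagator_exists torusDist_eq_l1_of_lt)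
open SupZdPropagatorUniqueness (zd_bounded_null_solution_eq_zero)

variable {d : ℕ}

/-! ## §1. `ℓ¹` block profiles on `ℤ^d` read as torus block profiles -/

/-- **THE TORUS DISTANCE OF PROJECTED POINTS IS AT MOST THEIR `ℓ¹` DISTANCE**: `ρ_s(σ b, σ c) ≤ Σ_i|b i − c i|`. [folklore] -/
theorem torusDist_le_l1 (s : ℕ) [NeZero s] (b c : X d) :
    ∑ i, ((((siteOf d s b) i - (siteOf d s c) i).valMinAbs.natAbs : ℕ) : ℝ) ≤ ∑ i, (((b i - c i).natAbs : ℕ) : ℝ) := by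
  refine Finset.sum_le_sum fun i _ => ?_
  have hc : (siteOf d s b) i - (siteOf d s c) i = (((b i - c i : ℤ)) : ZMod s) := by simp [siteOf, Int.cast_sub]
  rw [hc]
  exact_mod_cast natAbs_valMinAbs_le_of_intCast_eq (s := s) (((b i - c i : ℤ)) : ZMod s) (b i - c i) rfl

/-- **AN `ℓ¹` BLOCK PROFILE READS AS A TORUS BLOCK PROFILE**: `|f p| ≤ M·e^{−γ|blk n p − b₀|₁}` on `ℤ^d` (`γ ≥ 0`) ⟹ on the fine torus of coarse
period `s`, `|f(wm x)| ≤ M·e^{−γρ_s(bt x, σ b₀)}` at every site `x`. [folklore] -/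
theorem profile_window_reading (n s : ℕ) [NeZero s] (b₀ : X d) {M γ : ℝ} (hγ : 0 ≤ γ) (f : X d → ℝ)
    (hf : ∀ p, |f p| ≤ M * exp (-(γ * ∑ i, (((blk n p i - b₀ i).natAbs : ℕ) : ℝ)))) (x : Site d ((n + 1) * s)) :
    |f (windowMap d ((n + 1) * s) x)| ≤ M * exp (-(γ * ∑ i, ((((siteOf d s (blk n (windowMap d ((n + 1) * s) x))) i
      - (siteOf d s b₀) i).valMinAbs.natAbs : ℕ) : ℝ))) := by
  have hM : 0 ≤ M := by
    have h1 := (abs_nonneg _).trans (hf 0)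
    exact le_of_mul_le_mul_right (by rw [zero_mul]; exact h1) (exp_pos _)
  refine (hf _).trans (mul_le_mul_of_nonneg_left (exp_le_exp.2 ?_) hM)
  have := mul_le_mul_of_nonneg_left (torusDist_le_l1 (d := d) s (blk n (windowMap d ((n + 1) * s) x)) b₀) hγ
  linarith

/-! ## §2. `ℤ^d` solutions for sources with an exponential block profile -/

/-- **HEADLINE (profile sources) — `|f p| ≤ M·e^{−γ|blk n p − b₀|₁}` ⟹ A `ℤ^d` SOLUTION WITH `e^{δ|blk n p − b₀|₁}·|u p| ≤ C·M`**, for every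
`V : ℤ^d → [−λ, Λ]`, `d ≥ 3`, every mesh, `(C, δ)` from `(d, a, λ, Λ, γ)` and `C(d)` only: the tower limit ((180)) of the torus solutions
((148)), with (154) `pointwise_decay_road` at every level (the window reading of the profile is a torus profile, §1) passing to the limit
(torus distance = `ℓ¹` distance beyond the window radius). [folklore] -/
theorem zd_solution_of_profile_source (hd : 3 ≤ d) (a : ℝ) (ha : 0 < a) {lam Lam γ : ℝ} (hlam : lam < min 2 a) (hLam : 0 ≤ Lam)
    (hγ : 0 < γ) :
    ∃ C δ : ℝ, 0 < C ∧ 0 < δ ∧ ∀ (n : ℕ) (V : X d → ℝ), (∀ p, -lam ≤ V p) → (∀ p, V p ≤ Lam) →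
      ∀ (b₀ : X d) (M : ℝ) (f : X d → ℝ), (∀ p, |f p| ≤ M * exp (-(γ * ∑ i, (((blk n p i - b₀ i).natAbs : ℕ) : ℝ)))) →
      ∃ u : X d → ℝ,
        (∀ p, ((n : ℝ) + 1) ^ 2 * ∑ μ, (2 * u p - u (p + e μ) - u (p - e μ))
          + a / ((n : ℝ) + 1) ^ d * ∑ q ∈ B n (blk n p), u q + V p * u p = f p) ∧
        (∀ p, exp (δ * ∑ i, (((blk n p i - b₀ i).natAbs : ℕ) : ℝ)) * |u p| ≤ C * M) := by
  classical
  obtain ⟨C, δ, hC, hδ, H154⟩ := pointwise_decay_road (d := d) hd a ha hlam hLam hγ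
  refine ⟨C, δ, hC, hδ, ?_⟩
  intro n V hV hV' b₀ M f hf
  have hm0 : 0 < min 2 a - lam := by linarith
  have hM : 0 ≤ M := by
    have h1 := (abs_nonneg _).trans (hf 0)
    exact le_of_mul_le_mul_right (by rw [zero_mul]; exact h1) (exp_pos _)
  have hfM : ∀ p, |f p| ≤ M := fun p => (hf p).trans (by
    have : exp (-(γ * ∑ i, (((blk n p i - b₀ i).natAbs : ℕ) : ℝ))) ≤ 1 :=
      exp_le_one_iff.2 (neg_nonpos.2 (by positivity))
    nlinarith)
  choose useq husol using fun k : ℕ => action_surjective n a (3 ^ k) ha.le hm0 (fun x => V (windowMap d ((n + 1) * 3 ^ k) x))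
    (fun x => hV _) (fun x => f (windowMap d ((n + 1) * 3 ^ k) x))
  obtain ⟨u, hueq, hlim⟩ := tower_limit hd a ha hlam hLam n V hV hV' f hfM useq husol
  refine ⟨u, hueq, fun p => ?_⟩
  -- (154) at every level
  have hdec : ∀ k : ℕ, exp (δ * ∑ i, ((((siteOf d (3 ^ k) (blk n (windowMap d ((n + 1) * 3 ^ k) (siteOf d ((n + 1) * 3 ^ k) p)))) i
      - (siteOf d (3 ^ k) b₀) i).valMinAbs.natAbs : ℕ) : ℝ)) * |useq k (siteOf d ((n + 1) * 3 ^ k) p)| ≤ C * M := fun k =>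
    H154 n (3 ^ k) (fun x => V (windowMap d ((n + 1) * 3 ^ k) x)) (fun x => hV _) (fun x => hV' _) (siteOf d (3 ^ k) b₀) M (useq k)
      (fun x => f (windowMap d ((n + 1) * 3 ^ k) x)) (profile_window_reading n (3 ^ k) b₀ hγ.le f hf) (husol k) _
  set R : ℕ := ∑ i, (blk n p i - b₀ i).natAbs with hR
  have hev : ∀ᶠ k in atTop, exp (δ * ∑ i, (((blk n p i - b₀ i).natAbs : ℕ) : ℝ)) * |useq k (siteOf d ((n + 1) * 3 ^ k) p)| ≤ C * M := by
    refine Filter.eventually_atTop.2 ⟨2 * R + 1, fun k hk => ?_⟩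
    have hlt : ∀ i, 2 * (blk n p i - b₀ i).natAbs < 3 ^ k := fun i => by
      have h1 : (blk n p i - b₀ i).natAbs ≤ R :=
        Finset.single_le_sum (f := fun j => (blk n p j - b₀ j).natAbs) (fun _ _ => Nat.zero_le _) (Finset.mem_univ i)
      have h2 : k < 3 ^ k := Nat.lt_pow_self (by norm_num)
      omega
    have h := hdec k
    rw [blockOf_siteOf n (3 ^ k) p, torusDist_eq_l1_of_lt (3 ^ k) (blk n p) b₀ hlt] at h
    exact h
  exact le_of_tendsto ((hlim p).abs.const_mul _) hev

/-! ## §3. The bounded `ℤ^d` propagator is Lipschitz in the potential, in the decay currency -/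

/-- **HEADLINE (Lipschitz) — `e^{δ|blk n p − b₀|₁}·|u₁ p − u₂ p| ≤ C·‖V₁ − V₂‖_∞·‖f‖_∞` FOR BOUNDED SOLUTIONS OF `H_{V₁}u₁ = f = H_{V₂}u₂` ON `ℤ^d`**,
`f` supported in the block `b₀`, every `V₁, V₂ : ℤ^d → [−λ, Λ]`, `d ≥ 3`, every mesh: `u₂` IS (180)'s decaying solution ((181) uniqueness),
`w = u₁ − u₂` solves `H_{V₁}w = −(V₁ − V₂)u₂`, a profile source of size `D·C₀M`, so `w` IS §2's decaying solution ((181) again). [folklore] -/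
theorem zd_propagator_lipschitz_potential (hd : 3 ≤ d) (a : ℝ) (ha : 0 < a) {lam Lam : ℝ} (hlam : lam < min 2 a) (hLam : 0 ≤ Lam) :
    ∃ C δ : ℝ, 0 < C ∧ 0 < δ ∧ ∀ (n : ℕ) (V₁ V₂ : X d → ℝ), (∀ p, -lam ≤ V₁ p) → (∀ p, V₁ p ≤ Lam) →
      (∀ p, -lam ≤ V₂ p) → (∀ p, V₂ p ≤ Lam) → ∀ D : ℝ, (∀ p, |V₁ p - V₂ p| ≤ D) →
      ∀ (b₀ : X d) (M : ℝ) (f : X d → ℝ), (∀ p, blk n p ≠ b₀ → f p = 0) → (∀ p, |f p| ≤ M) →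
      ∀ (u₁ u₂ : X d → ℝ) (B₁ B₂ : ℝ), (∀ p, |u₁ p| ≤ B₁) → (∀ p, |u₂ p| ≤ B₂) →
      (∀ p, ((n : ℝ) + 1) ^ 2 * ∑ μ, (2 * u₁ p - u₁ (p + e μ) - u₁ (p - e μ))
        + a / ((n : ℝ) + 1) ^ d * ∑ q ∈ B n (blk n p), u₁ q + V₁ p * u₁ p = f p) →
      (∀ p, ((n : ℝ) + 1) ^ 2 * ∑ μ, (2 * u₂ p - u₂ (p + e μ) - u₂ (p - e μ))
        + a / ((n : ℝ) + 1) ^ d * ∑ q ∈ B n (blk n p), u₂ q + V₂ p * u₂ p = f p) →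
      ∀ p : X d, exp (δ * ∑ i, (((blk n p i - b₀ i).natAbs : ℕ) : ℝ)) * |u₁ p - u₂ p| ≤ C * D * M := by
  classical
  obtain ⟨C₀, δ₀, hC₀, hδ₀, H180⟩ := zd_propagator_exists (d := d) hd a ha hlam hLam
  obtain ⟨C₁, δ₁, hC₁, hδ₁, H2⟩ := zd_solution_of_profile_source (d := d) hd a ha hlam hLam hδ₀
  refine ⟨C₁ * C₀, δ₁, by positivity, hδ₁, ?_⟩
  intro n V₁ V₂ hV₁ hV₁' hV₂ hV₂' D hD b₀ M f hf hfM u₁ u₂ B₁ B₂ hu₁B hu₂B hu₁ hu₂ p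
  have hM : 0 ≤ M := (abs_nonneg _).trans (hfM 0)
  have hD0 : 0 ≤ D := (abs_nonneg _).trans (hD 0)
  -- `u₂` is (180)'s decaying solution, by uniqueness
  obtain ⟨v₂, hv₂eq, hv₂dec⟩ := H180 n V₂ hV₂ hV₂' b₀ M f hf hfM
  have hv₂B : ∀ q, |v₂ q| ≤ C₀ * M := fun q => by
    have h := hv₂dec q
    have h1 : (1 : ℝ) ≤ exp (δ₀ * ∑ i, (((blk n q i - b₀ i).natAbs : ℕ) : ℝ)) := one_le_exp (by positivity)
    nlinarith [abs_nonneg (v₂ q)]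
  have hu₂v₂ : u₂ = v₂ :=
    SupZdPropagatorUniqueness.zd_bounded_solution_unique hd a ha hlam hLam n V₂ hV₂ hV₂' f u₂ v₂ hu₂B hv₂B hu₂ hv₂eq
  -- `w = u₁ − u₂` solves `H_{V₁}w = −(V₁ − V₂)u₂`, a profile source
  set g : X d → ℝ := fun q => -((V₁ q - V₂ q) * u₂ q) with hg
  have hgprof : ∀ q, |g q| ≤ D * (C₀ * M) * exp (-(δ₀ * ∑ i, (((blk n q i - b₀ i).natAbs : ℕ) : ℝ))) := by
    intro q
    have h := hv₂dec q
    rw [← hu₂v₂] at h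
    have hE := exp_pos (δ₀ * ∑ i, (((blk n q i - b₀ i).natAbs : ℕ) : ℝ))
    have hu₂q : |u₂ q| ≤ C₀ * M * exp (-(δ₀ * ∑ i, (((blk n q i - b₀ i).natAbs : ℕ) : ℝ))) := by
      rw [exp_neg, ← div_eq_mul_inv, le_div_iff₀ hE, mul_comm]; exact h
    simp only [hg, abs_neg, abs_mul]
    calc |V₁ q - V₂ q| * |u₂ q| ≤ D * (C₀ * M * exp (-(δ₀ * ∑ i, (((blk n q i - b₀ i).natAbs : ℕ) : ℝ)))) :=
          mul_le_mul (hD q) hu₂q (abs_nonneg _) hD0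
      _ = _ := by ring
  have hw : ∀ q, ((n : ℝ) + 1) ^ 2 * ∑ μ, (2 * (u₁ q - u₂ q) - (u₁ (q + e μ) - u₂ (q + e μ)) - (u₁ (q - e μ) - u₂ (q - e μ)))
      + a / ((n : ℝ) + 1) ^ d * ∑ q' ∈ B n (blk n q), (u₁ q' - u₂ q') + V₁ q * (u₁ q - u₂ q) = g q := by
    intro q
    have e1 : ∑ μ, (2 * (u₁ q - u₂ q) - (u₁ (q + e μ) - u₂ (q + e μ)) - (u₁ (q - e μ) - u₂ (q - e μ)))
        = ∑ μ, (2 * u₁ q - u₁ (q + e μ) - u₁ (q - e μ)) - ∑ μ, (2 * u₂ q - u₂ (q + e μ) - u₂ (q - e μ)) := by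
      rw [← Finset.sum_sub_distrib]; exact Finset.sum_congr rfl fun μ _ => by ring
    rw [e1, Finset.sum_sub_distrib (f := u₁) (g := u₂)]
    have h1 := hu₁ q
    have h2 := hu₂ q
    simp only [hg]
    linarith
  -- §2's decaying solution for that source, and uniqueness
  obtain ⟨w', hw'eq, hw'dec⟩ := H2 n V₁ hV₁ hV₁' b₀ (D * (C₀ * M)) g hgprof
  have hw'B : ∀ q, |w' q| ≤ C₁ * (D * (C₀ * M)) := fun q => by
    have h := hw'dec q
    have h1 : (1 : ℝ) ≤ exp (δ₁ * ∑ i, (((blk n q i - b₀ i).natAbs : ℕ) : ℝ)) := one_le_exp (by positivity)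
    nlinarith [abs_nonneg (w' q)]
  have hww' : (fun q => u₁ q - u₂ q) = w' :=
    SupZdPropagatorUniqueness.zd_bounded_solution_unique hd a ha hlam hLam n V₁ hV₁ hV₁' g (fun q => u₁ q - u₂ q) w'
      (B₁ := B₁ + B₂) (fun q => (abs_sub _ _).trans (add_le_add (hu₁B q) (hu₂B q))) hw'B hw hw'eq
  have h := hw'dec p
  rw [← hww'] at h
  calc exp (δ₁ * ∑ i, (((blk n p i - b₀ i).natAbs : ℕ) : ℝ)) * |u₁ p - u₂ p| ≤ C₁ * (D * (C₀ * M)) := h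
    _ = C₁ * C₀ * D * M := by ring

/-! ## §4. Toy -/

/-- Toy (`d = 3`, `a = 1`, `λ = 0`, `Λ = 1`): the constants of the `ℤ^d` Lipschitz letter exist. -/
example : ∃ C δ : ℝ, 0 < C ∧ 0 < δ :=
  let ⟨C, δ, hC, hδ, _⟩ := zd_propagator_lipschitz_potential (d := 3) le_rfl 1 one_pos (lam := 0) (Lam := 1)
    (by rw [min_eq_right (by norm_num : (1 : ℝ) ≤ 2)]; norm_num) zero_le_one
  ⟨C, δ, hC, hδ⟩

end Summit.QuantumFields.BalabanUV.T4Continuum.NE7b.SupZdPropagatorProfile
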